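import Literature.Barriers.HubbardSuperconductivity.SourcedResponseEpsilonLift
import HarnessLib

/-!
# Barrier: the SLANTED ε-lift — every AFFINE multi-axis deformation family of a finite system has, at every
# precision ε > 0, an order-free companion family with the same deformed ground energies (within ε) and the
# same deformed ground states wherever the slanted energy gain exceeds ε

Barrier catalogue `Literature/Barriers/HubbardSuperconductivity/` (D-0021), entry `SourcedResponseEpsilonLiftSlanted`;
§2 of the entry `SourcedResponseEpsilonLift` (`SourcedResponseEpsilonLift.lean`), whose block API
(`EpsilonLift.lift A d = A ⊕ d`, `EpsilonLift.liftOp X = X ⊕ 0` on `n ⊕ Unit`, `groundEnergy_lift`,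
`groundStateFunctional_lift_liftOp_of_lt/_of_gt`) is used verbatim.  That entry treats ONE `U(1)`-breaking source
`O` with `Re ω_H(O) = 0` and an inert level at the CONSTANT energy `E₀(H) − ε`.  Here (cell `hubbard-cq`, lens
obstruction-first, seat obst-2 g3; census (42) / barrier note BN-g2-1 «no transfer rule from finitely many energy
windows on finitely many affine axes»):

* the deformation `W` is ANY Hermitian matrix — in applications the value `W = Σᵢ hᵢ Oᵢ` of an AFFINE
  multi-parameter family at the parameter point `h` (several sources at once; `U(1)`-INVARIANT axes such as a
  `t′`-hopping increment, a Zeeman or staggered field, a density–density term; mixed words);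
* the inert level is SLANTED: it sits at `E₀(H) − ε − b` with `b` a supergradient value of the concave map
  `W ↦ E₀(H − W)` at `0`, canonically the variational one `b = Re ω_H(W)` (`groundEnergy_sub_le_sub_re`; linear in
  `W`, so an affine family of deformations lifts to an affine family of slanted deformations
  `W ⊕ b = Σᵢ hᵢ (Oᵢ ⊕ bᵢ)`, `bᵢ = Re ω_H(Oᵢ)`: `lift_add`, `lift_smul_real`, `lift_sum_smul`, `slantLift_sum_axes`).

Profile (`slantedEpsilonLift_profile`; everything proved from the §1 API, no `sorry`, no named fact):
* `groundEnergy_slantLift`: `E₀((H ⊕ (E₀H − ε)) − (W ⊕ b)) = min (E₀(H − W)) (E₀H − ε − b)`;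
* `slantLift_energy_mem`: for a supergradient value `b` (`E₀(H − W) ≤ E₀H − b`) and `ε ≥ 0` the lifted deformed
  energy lies in `[E₀(H − W) − ε, E₀(H − W)]` — at every point of every affine axis SIMULTANEOUSLY;
* `slantLift_groundStateFunctional_of_gain_gt`: slanted gain `E₀H − b − E₀(H − W) > ε` ⇒ the lifted ground state
  is the physical one on every lifted observable (identical responses, correlations, structure factors);
* `slantLift_groundStateFunctional_of_gain_lt`: slanted gain `< ε` ⇒ the ground state is the inert level,
  `ω̃(X ⊕ 0) = 0` for all `X` (no order of any kind);
* `slantGain_nonneg`, `slantGain_le_two_mul_norm`: with the variational `b`, `0 ≤ gain ≤ 2‖W‖`, so the inert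
  regime contains the whole operator-norm ball `‖W‖ < ε/2` around the undeformed point
  (`slantLift_inert_of_norm_lt`): all first derivatives of the lifted energy at `0` are the slopes `bᵢ` exactly
  and all susceptibilities / cusps / correlations of the lifted system vanish there.

READING.  No transfer rule «finitely many certified energy windows of width `≥ ε` on finitely many AFFINE
deformation axes (plus rows read in deformed ground states with slanted gain `> ε`) ⇒ order / cusp /
susceptibility floor at the undeformed point» can hold at any precision, for any number of axes used jointly
(mixed second differences, channel contrasts, Zeeman × pair source, `t′`-chords, …).  What such data CAN carry
is unchanged from §1: fixed-parameter INSTRUMENT words at the deformed point itself, and inputs the lift violates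
(a volume-uniform modulus at `0⁺`; locality / tensor structure at total-energy resolution `ε`).
SCOPE: affine families only (`H − W`, `W` linear in the parameters).  An orbital-flux-density axis or a twist axis
is NOT affine in its parameter; the lift says nothing about them beyond their affine sections.

technique_class: symmetry-breaking-field pinning-field finite-field-response finite-precision-data epsilon-lift affine-deformation multi-axis energy-chord mixed-second-difference susceptibility inert-level Koma-Tasaki-converse response-to-LRO-transfer
blocks: every certificate mechanism of the shape "finitely many certified data of an AFFINE deformation family `H − Σᵢ hᵢ Oᵢ` of a finite system — ground-energy windows of width `≥ ε` at finitely many parameter points, and rows read in the deformed ground states at points whose slanted gain exceeds `ε` — ⇒ a FLOOR on an order parameter, a cusp, a susceptibility or a correlation of the UNDEFORMED ground state", for any class of systems closed under adjoining one inert level with an affine energy (cell `hubbard-cq` census (42), barrier note BN-g2-1; LADDER row PC-a/PC-c).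
because: the slanted ε-lift `H ⊕ (E₀(H) − ε)`, `Oᵢ ⊕ Re ω_H(Oᵢ)` reproduces every deformed ground energy within `ε` and every deformed ground state of slanted gain `> ε` exactly, and is inert (`ω̃(X ⊕ 0) = 0` for all `X`) on the ball `‖W‖ < ε/2` (theorem `SourcedResponseEpsilonLiftSlanted_holds`); the printed theory runs LRO ⇒ response only [cite: KomaTasaki1994, §1 and §2.5] [cite: LiebSeiringerYngvason2007, §3].
evasions_known: (i) certify the small-deformation GAIN itself (a volume-uniform modulus at `0⁺`, floor-type input — §1 evasion (i)); (ii) structure the single global inert level breaks: strict tensor-product locality of all states below `E₀ + ε` in total energy (§1 evasion (ii)); (iii) non-affine deformation axes (flux density, twists) are outside the statement; (iv) the proved direction LRO ⇒ response and direct LRO proofs [cite: KennedyLiebShastry1988].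
scope_caveats: a statement about TRANSFER PRINCIPLES from finite-precision data on affine axes, not about any model; one global inert level (block-diagonal), site-local / translation-invariant product version not formalised here; ties gain `= ε` excluded.
status: established (theorems `EpsilonLift.slantedEpsilonLift_profile`, `SourcedResponseEpsilonLiftSlanted_holds`).

## References
* T. Koma, H. Tasaki, J. Stat. Phys. 76 (1994) 745–803 (`KomaTasaki1994`): §1 (order parameters under a source;
  concavity of the sourced ground energy), §2.5 (the converse direction).
* H. Tasaki, *Physics and Mathematics of Quantum Many-Body Systems* (2020) (`Tasaki2020`): §2.1 (variational
  principle), App. A.2 (block matrices).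
* E. H. Lieb, R. Seiringer, J. Yngvason, Rep. Math. Phys. 59 (2007) 389 (`LiebSeiringerYngvason2007`): §3.
* T. Kennedy, E. H. Lieb, B. S. Shastry, J. Stat. Phys. 53 (1988) 1019 (`KennedyLiebShastry1988`).
* Cell memo: `run/shared/lean/pub/hubbard-cq/hubbard-cq-lens-obst-2/` (obst-2 g3, sketch
  `HOME/lean/obst2g3-SlantedEpsilonLiftSketch.lean`, 2026-08-27), adopted here with tree names.
-/

noncomputable section

open Matrix Complex
open scoped ComplexOrder Matrix.Norms.L2Operator

namespace Literature.Barriers.HubbardSuperconductivity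

open Literature.MathematicalPhysics.QuantumLattice

namespace EpsilonLift

variable {n : Type*} [Fintype n] [DecidableEq n]

/-! ### Affine bookkeeping of the lift -/

omit [Fintype n] [DecidableEq n] in
/-- Lifts subtract blockwise: `(H ⊕ d) − (W ⊕ b) = (H − W) ⊕ (d − b)`. [cite: Tasaki2020, App. A.2] -/
theorem lift_sub_lift (H W : Matrix n n ℂ) (d b : ℝ) :
    lift H d - lift W b = lift (H - W) (d - b) := by
  ext (i | i) (j | j) <;> simp [EpsilonLift.lift, sub_smul]

omit [Fintype n] [DecidableEq n] in
/-- Lifting is additive: `(W₁ ⊕ b₁) + (W₂ ⊕ b₂) = (W₁ + W₂) ⊕ (b₁ + b₂)` — an affine family of deformations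
lifts to an affine family. [cite: Tasaki2020, App. A.2] -/
theorem lift_add (W₁ W₂ : Matrix n n ℂ) (b₁ b₂ : ℝ) :
    lift W₁ b₁ + lift W₂ b₂ = lift (W₁ + W₂) (b₁ + b₂) := by
  ext (i | i) (j | j) <;> simp [EpsilonLift.lift, add_smul]

omit [Fintype n] [DecidableEq n] in
/-- Lifting commutes with real scaling: `c • (W ⊕ b) = (cW) ⊕ (cb)`. [cite: Tasaki2020, App. A.2] -/
theorem lift_smul_real (W : Matrix n n ℂ) (b c : ℝ) :
    (c : ℂ) • lift W b = lift ((c : ℂ) • W) (c * b) := by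
  ext (i | i) (j | j) <;> simp [EpsilonLift.lift]

omit [Fintype n] [DecidableEq n] in
/-- The trivial lift: `0 ⊕ 0 = 0`. [cite: Tasaki2020, App. A.2] -/
theorem lift_zero : lift (0 : Matrix n n ℂ) 0 = 0 := by
  ext (i | i) (j | j) <;> simp [EpsilonLift.lift]

omit [Fintype n] [DecidableEq n] in
/-- The lift with level `0` is the lifted observable: `X ⊕ 0 = liftOp X`. [cite: Tasaki2020, App. A.2] -/
theorem lift_zero_right (X : Matrix n n ℂ) : lift X 0 = liftOp X := by
  ext (i | i) (j | j) <;> simp [EpsilonLift.lift, EpsilonLift.liftOp]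

omit [Fintype n] [DecidableEq n] in
/-- **A finite affine family lifts termwise:** `Σᵢ hᵢ (Oᵢ ⊕ bᵢ) = (Σᵢ hᵢ Oᵢ) ⊕ (Σᵢ hᵢ bᵢ)`.
[cite: Tasaki2020, App. A.2] -/
theorem lift_sum_smul {ι : Type*} (s : Finset ι) (O : ι → Matrix n n ℂ) (b h : ι → ℝ) :
    ∑ i ∈ s, (h i : ℂ) • lift (O i) (b i) = lift (∑ i ∈ s, (h i : ℂ) • O i) (∑ i ∈ s, h i * b i) := by
  classical
  induction s using Finset.induction_on with
  | empty => simp [lift_zero]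
  | insert a s ha ih => rw [Finset.sum_insert ha, Finset.sum_insert ha, Finset.sum_insert ha, ih,
      lift_smul_real, lift_add]

variable [Nonempty n]

/-! ### The variational supergradient and the slanted profile -/

/-- **Variational supergradient.** For Hermitian `H`, `W`: `E₀(H − W) ≤ E₀(H) − Re ω_H(W)` (the tracial ground
state of `H` as a trial state for `H − W`).  With `W = Σ hᵢ Oᵢ` the right-hand side is affine in `h` with slopes
`bᵢ = Re ω_H(Oᵢ)` (`re_groundStateFunctional_sum_smul`). [cite: Tasaki2020, §2.1] -/
theorem groundEnergy_sub_le_sub_re {H W : Matrix n n ℂ} (hH : H.IsHermitian) (hW : W.IsHermitian) :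
    (H - W).groundEnergy ≤ H.groundEnergy - (H.groundStateFunctional W).re := by
  have key := groundEnergy_le_groundStateFunctional_re hH (hH.sub hW)
  rw [map_sub, groundStateFunctional_hamiltonian hH, Complex.sub_re, Complex.ofReal_re] at key
  exact key

omit [Nonempty n] in
/-- The variational slope is linear in the deformation: `Re ω_H(Σᵢ hᵢ Oᵢ) = Σᵢ hᵢ Re ω_H(Oᵢ)`.
[cite: Tasaki2020, §2.1] -/
theorem re_groundStateFunctional_sum_smul {ι : Type*} (H : Matrix n n ℂ) (s : Finset ι) (O : ι → Matrix n n ℂ)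
    (h : ι → ℝ) :
    (H.groundStateFunctional (∑ i ∈ s, (h i : ℂ) • O i)).re = ∑ i ∈ s, h i * (H.groundStateFunctional (O i)).re := by
  rw [map_sum, Complex.re_sum]
  refine Finset.sum_congr rfl fun i _ => ?_
  rw [LinearMap.map_smul, smul_eq_mul, Complex.re_ofReal_mul]

/-- **Energies of the slanted lift:** `E₀((H ⊕ (E₀H − ε)) − (W ⊕ b)) = min (E₀(H − W)) (E₀H − ε − b)`.
[cite: KomaTasaki1994, §1 and §2.5] -/
theorem groundEnergy_slantLift {H W : Matrix n n ℂ} (hH : H.IsHermitian) (hW : W.IsHermitian) (ε b : ℝ) :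
    (lift H (H.groundEnergy - ε) - lift W b).groundEnergy =
      min (H - W).groundEnergy (H.groundEnergy - ε - b) := by
  rw [lift_sub_lift, groundEnergy_lift (hH.sub hW)]

/-- **Sandwich on the whole family:** for a supergradient value `b` (`E₀(H − W) ≤ E₀H − b`) and `ε ≥ 0`, the
lifted deformed energy lies in `[E₀(H − W) − ε, E₀(H − W)]`. [cite: KomaTasaki1994, §1 and §2.5] -/
theorem slantLift_energy_mem {H W : Matrix n n ℂ} (hH : H.IsHermitian) (hW : W.IsHermitian) {ε b : ℝ}
    (hε : 0 ≤ ε) (hb : (H - W).groundEnergy ≤ H.groundEnergy - b) :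
    (H - W).groundEnergy - ε ≤ (lift H (H.groundEnergy - ε) - lift W b).groundEnergy ∧
      (lift H (H.groundEnergy - ε) - lift W b).groundEnergy ≤ (H - W).groundEnergy := by
  rw [groundEnergy_slantLift hH hW]
  exact ⟨le_min (by linarith) (by linarith), min_le_left _ _⟩

/-- **Physical states where the slanted gain exceeds ε:** `E₀H − b − E₀(H − W) > ε` ⇒ the tracial ground state
of the lifted deformed matrix agrees with that of `H − W` on every lifted observable.
[cite: KomaTasaki1994, §1 and §2.5] -/
theorem slantLift_groundStateFunctional_of_gain_gt {H W : Matrix n n ℂ} (hH : H.IsHermitian) (hW : W.IsHermitian)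
    {ε b : ℝ} (hgain : ε < H.groundEnergy - b - (H - W).groundEnergy) (X : Matrix n n ℂ) :
    (lift H (H.groundEnergy - ε) - lift W b).groundStateFunctional (liftOp X) =
      (H - W).groundStateFunctional X := by
  rw [lift_sub_lift]
  exact groundStateFunctional_lift_liftOp_of_gt (hH.sub hW) (by linarith) X

/-- **Inert state where the slanted gain is below ε:** `E₀H − b − E₀(H − W) < ε` ⇒ every lifted observable has
expectation `0` in the tracial ground state of the lifted deformed matrix (no response beyond the slope, no
correlations, no order). [cite: KomaTasaki1994, §1 and §2.5] -/
theorem slantLift_groundStateFunctional_of_gain_lt {H W : Matrix n n ℂ} (hH : H.IsHermitian) (hW : W.IsHermitian)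
    {ε b : ℝ} (hgain : H.groundEnergy - b - (H - W).groundEnergy < ε) (X : Matrix n n ℂ) :
    (lift H (H.groundEnergy - ε) - lift W b).groundStateFunctional (liftOp X) = 0 := by
  rw [lift_sub_lift]
  exact groundStateFunctional_lift_liftOp_of_lt (hH.sub hW) (by linarith) X

/-- With the variational slope `b = Re ω_H(W)` the slanted gain is non-negative … [cite: Tasaki2020, §2.1] -/
theorem slantGain_nonneg {H W : Matrix n n ℂ} (hH : H.IsHermitian) (hW : W.IsHermitian) :
    0 ≤ H.groundEnergy - (H.groundStateFunctional W).re - (H - W).groundEnergy := by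
  have := groundEnergy_sub_le_sub_re hH hW
  linarith

/-- … and at most `2‖W‖` (operator norm): the inert regime of the variationally slanted ε-lift contains the
ball `‖W‖ < ε/2` around the undeformed point, on every affine axis through it at once. [cite: Tasaki2020, §2.1] -/
theorem slantGain_le_two_mul_norm {H W : Matrix n n ℂ} (hH : H.IsHermitian) (hW : W.IsHermitian) :
    H.groundEnergy - (H.groundStateFunctional W).re - (H - W).groundEnergy ≤ 2 * ‖W‖ := by
  have hHW := hH.sub hW
  -- `E₀(H) ≤ Re ω_{H−W}(H) = E₀(H − W) + Re ω_{H−W}(W)`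
  have key := groundEnergy_le_groundStateFunctional_re hHW hH
  have e1 : (H - W).groundStateFunctional H =
      (H - W).groundStateFunctional (H - W) + (H - W).groundStateFunctional W := by
    rw [← map_add, sub_add_cancel]
  rw [e1, groundStateFunctional_hamiltonian hHW, Complex.add_re, Complex.ofReal_re] at key
  have h1 := abs_re_groundStateFunctional_le_norm hH W
  have h2 := abs_re_groundStateFunctional_le_norm hHW W
  rw [abs_le] at h1 h2
  linarith [h1.1, h2.2]

/-- **The inert ball:** with the variational slope, `‖W‖ < ε/2` puts the lifted system in its inert ground state —
every lifted observable has expectation `0`. [cite: KomaTasaki1994, §1 and §2.5] -/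
theorem slantLift_inert_of_norm_lt {H W : Matrix n n ℂ} (hH : H.IsHermitian) (hW : W.IsHermitian) {ε : ℝ}
    (hsmall : ‖W‖ < ε / 2) (X : Matrix n n ℂ) :
    (lift H (H.groundEnergy - ε) - lift W (H.groundStateFunctional W).re).groundStateFunctional (liftOp X) = 0 :=
  slantLift_groundStateFunctional_of_gain_lt hH hW (by have := slantGain_le_two_mul_norm hH hW; linarith) X

omit [Nonempty n] in
/-- **Two affine axes at once:** the slanted lift of `H − h₁O₁ − h₂O₂` is the affine family `H̃ − h₁Õ₁ − h₂Õ₂`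
with `H̃ = H ⊕ (E₀H − ε)`, `Õᵢ = Oᵢ ⊕ bᵢ`. [cite: Tasaki2020, App. A.2] -/
theorem slantLift_two_axes (H O₁ O₂ : Matrix n n ℂ) (ε b₁ b₂ h₁ h₂ : ℝ) :
    lift H (H.groundEnergy - ε) - (h₁ : ℂ) • lift O₁ b₁ - (h₂ : ℂ) • lift O₂ b₂ =
      lift (H - (h₁ : ℂ) • O₁ - (h₂ : ℂ) • O₂) (H.groundEnergy - ε - h₁ * b₁ - h₂ * b₂) := by
  rw [lift_smul_real, lift_smul_real, lift_sub_lift, lift_sub_lift]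

omit [Nonempty n] in
/-- **Any finite number of affine axes:** `H̃ − Σᵢ hᵢ Õᵢ = (H − Σᵢ hᵢ Oᵢ) ⊕ (E₀H − ε − Σᵢ hᵢ bᵢ)`.
[cite: Tasaki2020, App. A.2] -/
theorem slantLift_sum_axes {ι : Type*} (H : Matrix n n ℂ) (s : Finset ι) (O : ι → Matrix n n ℂ)
    (ε : ℝ) (b h : ι → ℝ) :
    lift H (H.groundEnergy - ε) - ∑ i ∈ s, (h i : ℂ) • lift (O i) (b i) =
      lift (H - ∑ i ∈ s, (h i : ℂ) • O i) (H.groundEnergy - ε - ∑ i ∈ s, h i * b i) := by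
  rw [lift_sum_smul, lift_sub_lift]

/-- **The slanted ε-lift profile** (everything in one statement).  For Hermitian `H` on a nonempty finite index
type and `ε > 0`, with `H̃ = H ⊕ (E₀(H) − ε)` and the VARIATIONALLY slanted embedding `W ↦ W ⊕ Re ω_H(W)`:
(o) `H̃` Hermitian, `W ⊕ b` Hermitian for Hermitian `W`; `X ⊕ 0` is a `*`-embedding and symmetries of `H` lift;
the embedding is affine (`lift_add`, `lift_smul_real`);
for every Hermitian deformation `W`, with gain `g(W) = E₀(H) − Re ω_H(W) − E₀(H − W) ∈ [0, 2‖W‖]`: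
(i) `E₀(H − W) − ε ≤ E₀(H̃ − (W ⊕ Re ω_H W)) ≤ E₀(H − W)`;
(ii) `g(W) > ε` ⇒ `ω̃_W(X ⊕ 0) = ω_W(X)` for all `X`;
(iii) `g(W) < ε` ⇒ `ω̃_W(X ⊕ 0) = 0` for all `X`, in particular whenever `‖W‖ < ε/2`.
[cite: KomaTasaki1994, §1 and §2.5] -/
theorem slantedEpsilonLift_profile {H : Matrix n n ℂ} (hH : H.IsHermitian) {ε : ℝ} (hε : 0 < ε) :
    (lift H (H.groundEnergy - ε)).IsHermitian ∧
    (∀ (W : Matrix n n ℂ) (b : ℝ), W.IsHermitian → (lift W b).IsHermitian) ∧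
    (∀ X Y : Matrix n n ℂ, lift X 0 * lift Y 0 = lift (X * Y) 0) ∧
    (∀ X : Matrix n n ℂ, (lift X 0)ᴴ = lift Xᴴ 0) ∧
    (∀ C : Matrix n n ℂ, C * H = H * C → lift C 0 * lift H (H.groundEnergy - ε) = lift H (H.groundEnergy - ε) * lift C 0) ∧
    (∀ W : Matrix n n ℂ, W.IsHermitian →
      (0 ≤ H.groundEnergy - (H.groundStateFunctional W).re - (H - W).groundEnergy ∧
        H.groundEnergy - (H.groundStateFunctional W).re - (H - W).groundEnergy ≤ 2 * ‖W‖) ∧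
      ((H - W).groundEnergy - ε ≤
          (lift H (H.groundEnergy - ε) - lift W (H.groundStateFunctional W).re).groundEnergy ∧
        (lift H (H.groundEnergy - ε) - lift W (H.groundStateFunctional W).re).groundEnergy ≤
          (H - W).groundEnergy) ∧
      (ε < H.groundEnergy - (H.groundStateFunctional W).re - (H - W).groundEnergy → ∀ X : Matrix n n ℂ,
        (lift H (H.groundEnergy - ε) - lift W (H.groundStateFunctional W).re).groundStateFunctional (lift X 0) =
          (H - W).groundStateFunctional X) ∧
      (H.groundEnergy - (H.groundStateFunctional W).re - (H - W).groundEnergy < ε → ∀ X : Matrix n n ℂ,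
        (lift H (H.groundEnergy - ε) - lift W (H.groundStateFunctional W).re).groundStateFunctional (lift X 0) = 0) ∧
      (‖W‖ < ε / 2 → ∀ X : Matrix n n ℂ,
        (lift H (H.groundEnergy - ε) - lift W (H.groundStateFunctional W).re).groundStateFunctional (lift X 0) = 0)) := by
  refine ⟨isHermitian_lift hH _, fun W b hW => isHermitian_lift hW b, fun X Y => ?_, fun X => ?_, fun C hC => ?_,
    fun W hW => ⟨⟨slantGain_nonneg hH hW, slantGain_le_two_mul_norm hH hW⟩,
      slantLift_energy_mem hH hW hε.le (groundEnergy_sub_le_sub_re hH hW), fun hg X => ?_, fun hg X => ?_,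
      fun hsmall X => ?_⟩⟩
  · rw [lift_zero_right, lift_zero_right, lift_zero_right, liftOp_mul]
  · rw [lift_zero_right, lift_zero_right, liftOp_conjTranspose]
  · rw [lift_zero_right]; exact liftOp_mul_lift_comm hC _
  · rw [lift_zero_right]; exact slantLift_groundStateFunctional_of_gain_gt hH hW hg X
  · rw [lift_zero_right]; exact slantLift_groundStateFunctional_of_gain_lt hH hW hg X
  · rw [lift_zero_right]; exact slantLift_inert_of_norm_lt hH hW hsmall X

end EpsilonLift

open EpsilonLift

/-- **BARRIER `SourcedResponseEpsilonLiftSlanted` (finite-precision data on finitely many AFFINE deformation axes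
never floor the order, a cusp or a susceptibility at the undeformed point).**  For every finite-dimensional
Hermitian `H` (nonempty index type) and every precision `ε > 0` there are a Hermitian `H̃` on a larger finite index
type and an AFFINE embedding `(W, b) ↦ W ⊕ b` of deformations (observables are `X ⊕ 0`, a `*`-embedding under
which symmetries of `H` become symmetries of `H̃`) such that for EVERY Hermitian deformation `W` — every point of
every affine family `W = Σᵢ hᵢ Oᵢ` at once — with the variational slope `b = Re ω_H(W)` and the slanted gain
`g(W) = E₀(H) − b − E₀(H − W) ∈ [0, 2‖W‖]`:
(i) `E₀(H − W) − ε ≤ E₀(H̃ − (W ⊕ b)) ≤ E₀(H − W)` (all deformed energies reproduced to precision `ε`; all slopes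
at `0` reproduced exactly);
(ii) `g(W) > ε` ⇒ `ω̃_W(X ⊕ 0) = ω_W(X)` for every `X` (identical deformed ground states — responses, structure
factors, everything);
(iii) `g(W) < ε`, in particular on the ball `‖W‖ < ε/2` ⇒ `ω̃_W(X ⊕ 0) = 0` for every `X` (no order, no cusp, no
susceptibility, no correlation at and near the undeformed point).
Consequently any implication "certified data of precision `ε` on finitely many affine axes (energy windows; rows in
deformed ground states of gain `> ε`) ⇒ floor on an order parameter / cusp / susceptibility / correlation of the
undeformed ground state" fails at EVERY `ε` over any class of systems closed under `H ↦ H ⊕ (E₀(H) − ε)` with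
affinely slanted sources.  Witness: `EpsilonLift.lift` on `n ⊕ Unit`.

technique_class: symmetry-breaking-field pinning-field finite-field-response finite-precision-data epsilon-lift affine-deformation multi-axis energy-chord mixed-second-difference susceptibility inert-level Koma-Tasaki-converse response-to-LRO-transfer
blocks: "finitely many certified data of precision ε on finitely many AFFINE deformation axes ⇒ FLOOR on order / cusp / susceptibility / correlation at the undeformed point" as a transfer principle over classes of finite systems closed under adjoining one inert level with affine energy (cell `hubbard-cq` census (42), barrier note BN-g2-1; LADDER rows PC-a/PC-c).
because: the slanted ε-lift reproduces all deformed ground energies within ε (slopes at `0` exactly) and all deformed ground states of slanted gain `> ε` exactly, while being inert on `‖W‖ < ε/2` (`SourcedResponseEpsilonLiftSlanted_holds`); printed theory runs LRO ⇒ response only [cite: KomaTasaki1994, Corollary 2.9 and §2.5] [cite: LiebSeiringerYngvason2007, §3].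
evasions_known: certify the small-deformation gain / a modulus at `0⁺` (floor-type); strict locality below total energy `E₀ + ε`; non-affine axes (flux density, twists) are outside the statement; the proved direction and direct LRO proofs [cite: KennedyLiebShastry1988].
scope_caveats: transfer principles, not models; one global inert level (block-diagonal), site-local version not formalised; ties gain `= ε` excluded; affine families only.
status: established (theorem `SourcedResponseEpsilonLiftSlanted_holds`).
[cite: KomaTasaki1994, §1 and §2.5] [cite: LiebSeiringerYngvason2007, §3] -/
def SourcedResponseEpsilonLiftSlanted : Prop :=
  ∀ (n : Type) [Fintype n] [DecidableEq n] [Nonempty n] (H : Matrix n n ℂ), H.IsHermitian → ∀ ε : ℝ, 0 < ε →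
    ∃ (m : Type) (_ : Fintype m) (_ : DecidableEq m) (_ : Nonempty m) (Ht : Matrix m m ℂ)
      (emb : Matrix n n ℂ → ℝ → Matrix m m ℂ),
      Ht.IsHermitian ∧ (∀ (W : Matrix n n ℂ) (b : ℝ), W.IsHermitian → (emb W b).IsHermitian) ∧
      (∀ X Y : Matrix n n ℂ, emb X 0 * emb Y 0 = emb (X * Y) 0) ∧ (∀ X : Matrix n n ℂ, (emb X 0)ᴴ = emb Xᴴ 0) ∧
      (∀ (W₁ W₂ : Matrix n n ℂ) (b₁ b₂ : ℝ), emb W₁ b₁ + emb W₂ b₂ = emb (W₁ + W₂) (b₁ + b₂)) ∧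
      (∀ (W : Matrix n n ℂ) (b c : ℝ), (c : ℂ) • emb W b = emb ((c : ℂ) • W) (c * b)) ∧
      (∀ C : Matrix n n ℂ, C * H = H * C → emb C 0 * Ht = Ht * emb C 0) ∧
      ∀ W : Matrix n n ℂ, W.IsHermitian →
        (0 ≤ H.groundEnergy - (H.groundStateFunctional W).re - (H - W).groundEnergy ∧
          H.groundEnergy - (H.groundStateFunctional W).re - (H - W).groundEnergy ≤ 2 * ‖W‖) ∧
        ((H - W).groundEnergy - ε ≤ (Ht - emb W (H.groundStateFunctional W).re).groundEnergy ∧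
          (Ht - emb W (H.groundStateFunctional W).re).groundEnergy ≤ (H - W).groundEnergy) ∧
        (ε < H.groundEnergy - (H.groundStateFunctional W).re - (H - W).groundEnergy → ∀ X : Matrix n n ℂ,
          (Ht - emb W (H.groundStateFunctional W).re).groundStateFunctional (emb X 0) =
            (H - W).groundStateFunctional X) ∧
        (H.groundEnergy - (H.groundStateFunctional W).re - (H - W).groundEnergy < ε → ∀ X : Matrix n n ℂ,
          (Ht - emb W (H.groundStateFunctional W).re).groundStateFunctional (emb X 0) = 0) ∧
        (‖W‖ < ε / 2 → ∀ X : Matrix n n ℂ,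
          (Ht - emb W (H.groundStateFunctional W).re).groundStateFunctional (emb X 0) = 0)

/-- **`SourcedResponseEpsilonLiftSlanted` holds** — witnessed by `m = n ⊕ Unit`, `Ht = lift H (E₀(H) − ε)`,
`emb = lift` (`slantedEpsilonLift_profile`, `lift_add`, `lift_smul_real`). [cite: KomaTasaki1994, §1 and §2.5] -/
theorem SourcedResponseEpsilonLiftSlanted_holds : SourcedResponseEpsilonLiftSlanted := by
  intro n _ _ _ H hH ε hε
  obtain ⟨hHt, hWt, hmul, hct, hsym, hW⟩ := slantedEpsilonLift_profile hH hε
  exact ⟨n ⊕ Unit, inferInstance, inferInstance, inferInstance, lift H (H.groundEnergy - ε), lift, hHt, hWt,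
    hmul, hct, lift_add, fun W b c => lift_smul_real W b c, hsym, hW⟩

end Literature.Barriers.HubbardSuperconductivity
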